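import Summits.BirchSwinnertonDyer.BirchSwinnertonDyer.Theorems.EdixhovenFibreFiveSevenStarredOptimalManinUnitFiveSevenCdtThm1
import HarnessLib

set_option autoImplicit false
-- the sub-problem namespace `Summit.BirchSwinnertonDyer.BirchSwinnertonDyer` duplicates a component by design (D-0017)
set_option linter.dupNamespace false

/-!
# Crux TDS57 `TwistDegreeStepFiveSeven` (stmt-BirchSwinnertonDyer-22227), closed by name

The twist-degree step at `p ∈ {5, 7}`: granted modularity (the item's own first binder), for `V/ℚ` globally
minimal, additive at `p` with no `Iₙ*` fibre, `ord_p Δ_min ≤ 4`, `E[p]` irreducible, and `W♭` a globally minimal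
model of the `p*`-twist, some conductor-level datum `D` of `V` has `v_p(deg D) < v_p(deg D♭)` for every
conductor-level datum `D♭` of `W♭`.

The landed conditional closer `EdixhovenFibreFiveSevenOfCDTInt.twistDegreeStepFiveSeven_of_CDTInt` (p811415:
a datum with `p ∤ c` from `exists_datum_not_dvd_c_of_CDTInt`, then the twist identity
`TwistDegreeStepFiveSeven.twistDegreeStep57_of_not_dvd_c`, [EdixhovenManin1991, §4] / [ZagierCMB1985, §1]) takes
exactly the printed Calegari–Dimitrov–Tang Theorem 1.0.1 as hypothesis; that hypothesis is now the tree theorem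
`calegariDimitrovTang2025_unboundedDenominators_holds` (p826028, line `cdt_thm1` of crux K★).  Composing the two
proves the item BY NAME.

BSD is not proved by this; Manin's conjecture is not proved by this (the statement is the route's twist-degree
inequality at `p ∈ {5, 7}` only). [cite: CalegariDimitrovTang2025, Thm. 1.0.1] [cite: EdixhovenManin1991, §4]
[cite: ZagierCMB1985, §1 (p. 374)]
-/

namespace Summit.BirchSwinnertonDyer.BirchSwinnertonDyer.Theorems

/-- **Crux TDS57 `TwistDegreeStepFiveSeven` (stmt-BirchSwinnertonDyer-22227), proved by name**: the twist-degree
inequality `v_p(deg D) < v_p(deg D♭)` at `p ∈ {5, 7}` for unstarred additive `V` with `E[p]` irreducible against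
every conductor-level datum of the `p*`-twist — from CDT Theorem 1.0.1
(`calegariDimitrovTang2025_unboundedDenominators_holds`) through
`EdixhovenFibreFiveSevenOfCDTInt.twistDegreeStepFiveSeven_of_CDTInt`.  BSD is NOT proved by this.
[cite: CalegariDimitrovTang2025, Thm. 1.0.1] [cite: EdixhovenManin1991, §4 (cases 1/2)] -/
theorem TwistDegreeStepFiveSeven_proof :
    Summit.BirchSwinnertonDyer.BirchSwinnertonDyer.Theses.EdixhovenFibreFiveSeven.TwistDegreeStepFiveSeven :=
  EdixhovenFibreFiveSevenOfCDTInt.twistDegreeStepFiveSeven_of_CDTInt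
    calegariDimitrovTang2025_unboundedDenominators_holds

end Summit.BirchSwinnertonDyer.BirchSwinnertonDyer.Theorems
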